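import Summits.QuantumFields.YangMills.Theses.ThermalRuler
import Summits.QuantumFields.YangMills.Theorems.ParabolicTrajectoryContinuumLimitOnTrajectoryStubOSLegsD_Assembly
import Summits.QuantumFields.YangMills.Theorems.ParabolicTrajectoryContinuumLimitOnTrajectoryStubArp
import Summits.QuantumFields.YangMills.Theorems.ParabolicTrajectoryContinuumLimitOnTrajectoryStubTransl
import Summits.QuantumFields.YangMills.Theorems.ParabolicTrajectoryContinuumLimitOnTrajectoryUvbOfUuvb
import Summits.QuantumFields.YangMills.Theorems.ParabolicTrajectoryContinuumLimitOnTrajectorySlabRP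
import Summits.QuantumFields.YangMills.Theorems.ParabolicTrajectoryLatticeGapOnTrajectoryTransferSymDefs
import Summits.QuantumFields.YangMills.Theorems.ConvexGribovBodyContinuumLegGivenGapStubExtract
import Summits.QuantumFields.YangMills.Theorems.ConvexGribovBodyContinuumLegGivenGapStubAsympCS
import Summits.QuantumFields.YangMills.Theorems.ConvexGribovBodyContinuumLegGivenGapStubSmallRotation
import Summits.QuantumFields.YangMills.Theorems.ConvexGribovBodyContinuumLegGivenGapStubBddSlabDensity
import Summits.QuantumFields.YangMills.Theorems.ConvexGribovBodyContinuumLegGivenGapStubUclOfCscl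
import Literature.Barriers.QuantumFields.UVStabilityNonUniqueness
import Literature.MathematicalPhysics.QuantumFieldTheory.MassGapFromLatticeClustering

/-!
# Birth skeleton (BC3) for crux `ContinuumFromMixing` (stmt-QuantumFields-16115) — `Lines/birth.lean`

Registrar: `planner-skel-stmt-QuantumFields-16115-0` (skeleton-register one-shot; route
`route-QuantumFields-ThermalRuler`, re-audit bin REPAIRABLE), 2026-08-17.

Crux (route file `Theses/ThermalRuler.lean`, decl
`Summit.QuantumFields.YangMills.Theses.ThermalRuler.ContinuumFromMixing`, rank 5 — THE UV/OS LEG OF THE IR-FIRST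
ASSEMBLY, SHARP FORM): for every compact simple `G` (Borel σ-algebra), faithful lattice representation `r` and couplings
`b_k → ∞`: IF Wilson's theory in `r` has strong exponential decay of the DLR kernels along `b` (Chatterjee's Def. 2.3,
`K₁ = 4`, SOME admissible rates `m_k ∈ (0,1]`, inlined) AND EVERY admissible rate sequence tends to `0`, THEN the
re-typed Clay clause holds for `(G, r)`: `∃ sch T, sch.HasWeakCouplingLimit ∧ IsYangMillsFor r sch T ∧ T.IsNontrivial
r.curvature ∧ T.IsNonGaussian r.curvature ∧ ∃ Δ > 0, T.HasMassGap Δ ∧ HasLatticeMassGap r sch Δ`.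

## The cut — the route's own two-layer plan, typed: mass renormalisation + four named burdens

The route header files this crux with the plan "ContinuumFromMixing ⇐ TightnessAndGapTransfer (mass-renormalised
scheme `a := m*/Δ`, clustering passes to the limit) → RotationInvarianceE1 → NontrivialNonGaussianCurvature" and
names as genuinely open: E1, the non-Gaussian renormalisation of `tr F²`, strong ⇒ volume-uniform torus clustering,
and `ξ_strong ≍ ξ_bulk`. The skeleton types exactly these, docking on LANDED theorems only (no other crux's live
skeleton is imported):

* route ParabolicTrajectory's one-field vocabulary and PROVED Osterwalder–Schrader packaging (crux
  `ContinuumLimitOnTrajectory`, line two-orbit-synchronisation, `Theorems/ParabolicTrajectoryContinuumLimitOnTrajectory*`):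
  `canon` (c_{tr F²} = a⁻⁴, torus-mean centring, other species `0`), `UUVB`, `UVB`, `ConvProducts`, `AsympTransl/Rot/Euclid`,
  `ARP`, `UCL`, `ND2`, `ND3`, `PolyVolumeGrowth`, `TorusSlabRP`; `oneFieldOSLegs'` (p90720:
  `ConvProducts → UVB → AsympEuclid → ARP → UCL → ND2 → ND3 → ∃ T, IsYangMillsFor r (canon r sch) T ∧ NT ∧ NG`),
  `stub_arp : TorusSlabRP → UUVB → UVB → ARP`, `stub_transl : PolyVolumeGrowth → UUVB → AsympTransl`, `uvb_of_uuvb`,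
  `asympEuclid_iff`, `torusSlabRP_of_tendsto` (odd-torus reflection positivity from `β_k → ∞`, proved);
* route ParabolicTrajectory crux B's satisfiable lattice-gap currency `Transfer.UniformSlabClustering`
  (`…LatticeGapOnTrajectoryTransferSymDefs`);
* route ConvexGribovBody's landed glue for crux `ContinuumLegGivenGap` (`Theorems/ConvexGribovBodyContinuumLegGivenGap*`):
  `exists_subseq_convProducts_of_uuvb` (compactness: UUVB ⇒ `ConvProducts` along a sub-scheme, p126320),
  `stub_uclOfCscl` with `stub_asympCS`/`stub_smallRotation`/`stub_bddSlabDensity` (UCL from Cauchy–Schwarz clustering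
  + rotations + UUVB + volume growth + weak coupling);
* Literature: `subScheme` API (`UVStabilityNonUniqueness`), `IsYangMillsFor.hasMassGap_of_hasCSClustering`
  (`MassGapFromLatticeClustering`).

Stubs (the ONLY six `sorry`s):
1. `stub_mixingTransfer` (∃; IR, L–XL): crux hypotheses ⇒ a mass-renormalised weak-coupling scheme — `β` a subsequence of
   `b`, polynomial volume growth, `Δ·a_k` an admissible strong rate and `C·Δ·a_k` not (two-sided pin of the spacing to the
   strong mixing length; `a_k → 0` IS the softening hypothesis), `HasLatticeMassGap r sch Δ`, `UniformSlabClustering r sch Δ`.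
2. `stub_csClusteringTransfer` (∀; L, RP kinematics): weak + PVG + UUVB + uniform slab clustering ⇒
   `HasCSClustering r (canon r sch) Δ'` for some `Δ' > 0`.
3. `stub_uniformUVBounds` (∀; open, E0′): weak + PVG ⇒ `UUVB r sch`.
4. `stub_rotationRestoration` (∀; open, E1): weak + PVG + ConvProducts + UUVB ⇒ `AsympRot r sch` (= the E1 stub of the
   `OneCertifiedCube.ContinuumLimitExists` birth skeleton).
5. `stub_scaleComparability` (∀; open, `ξ_strong ≍ ξ_bulk`): two-sided strong pin ⇒ bulk lower pin (`∃ Δ₂ > 0`, eventually no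
   volume-uniform torus clustering at rate `Δ₂ a_k`).
6. `stub_nonDegenerateCurvature` (∀; open, NT/NG): weak + `HasLatticeMassGap Δ` + bulk lower pin + UUVB ⇒ `ND2 ∧ ND3`.

Composition (`compose`, sorry-free; `ContinuumFromMixing_of` = `compose` fed with the six stubs BY NAME): stub 1 gives
`(sch, Δ, C)`; stub 3 gives `UUVB`; stub 5 the bulk pin; stub 6 `ND2 ∧ ND3`; stub 2 `HasCSClustering (canon) Δ'`;
compactness extracts `ψ` with `ConvProducts r (subScheme sch ψ)`; every clause rides along `ψ` (glue lemmas §2,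
definitional); stub 4 gives `AsympRot` for the sub-scheme, `stub_transl` the translations, hence `AsympEuclid`;
`torusSlabRP_of_tendsto` + `stub_arp` give `ARP`; `stub_uclOfCscl` gives `UCL`; `oneFieldOSLegs'` packages `T` over ALL
species with `IsYangMillsFor r (canon r sch₂) T`, non-trivial, non-Gaussian; the continuum gap at `min Δ Δ'` by
`hasMassGap_of_hasCSClustering`, the lattice gap by `hasLatticeMassGap_subScheme` (same `a, β, L` for `canon`).
Witness: `(canon r (subScheme sch ψ hψ), T, min Δ Δ')`.

## Status (honest)
Stubs 3–6 are open-problem class (UV regularity, E1, and the two halves of the route's own why-might-fail: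
`ξ_strong ≍ ξ_bulk` and a non-Gaussian `tr F²` at the confinement scale); stubs 1–2 are the plausibly provable
transfers that make the strong-mixing hypotheses load-bearing (stub 1 consumes BOTH crux hypotheses: the decay for the
gap clauses and the pin, the softening for `a_k → 0`). No stub is cheaply the crux or the summit (BC3 probes
`stub → ContinuumFromMixing`, `stub → YangMills` by `first | exact? | simpa | aesop` fail 12/12, registrar folder
`bc/ContinuumFromMixing_probe.lean`). Convention inherited from the sibling lines: the one-field witness `canon`
(legal: other species renormalised to `0`; `c = a⁻⁴` exactly).

## Disproof used
No `Cruxes/ContinuumFromMixing/Disproof.lean` exists (no workfiles before this one); negatives index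
(`ledger negatives --problem QuantumFields`, 5 entries, 2026-08-17): none concerns these predicates. Recorded dead
currency avoided: PT's slack-free `TorusOSGap` is unsatisfiable on a periodic torus (ConvexGribovBody `Lines/Sketch.md`),
so the lattice gap is carried as `HasLatticeMassGap` + `UniformSlabClustering` (sup-norm) and converted to
`HasCSClustering` (ε-slack) by stub 2. Barriers: `FixedCouplingUltralocality` — `β_k → ∞` and `a_k → 0` are threaded
(stub 1), and the ultralocal failure mode is isolated as stub 5; `ScalarPhi4Triviality` — met head-on by stub 6;
`UVStabilityNonUniqueness` — evaded as the summit allows: convergence only along an extracted subsequence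
(`subScheme`, compactness is landed), no full-sequence uniqueness claimed.

`lean check`: rc 0; sorries = 6 = stubs, zero elsewhere. Namespace
`Summit.QuantumFields.YangMills.Cruxes.ContinuumFromMixing.Birth`.
-/

set_option autoImplicit false

noncomputable section

namespace Summit.QuantumFields.YangMills.Cruxes.ContinuumFromMixing.Birth

open Filter Topology
open scoped SchwartzMap
open Literature.MathematicalPhysics.QuantumFieldTheory
open Literature.Barriers.QuantumFields (subScheme hasLatticeMassGap_subScheme hasWeakCouplingLimit_subScheme)
open Summit.QuantumFields.YangMills.Cruxes.ContinuumLimitOnTrajectory.TwoOrbitSynchronisation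
  (canon curvNPoint curvDistribution canonDistribution plaq PlaqIdx UUVB UVB ConvProducts PolyVolumeGrowth
   AsympTransl AsympRot AsympEuclid ARP UCL ND2 ND3 TorusSlabRP oneFieldOSLegs' stub_arp stub_transl uvb_of_uuvb
   asympEuclid_iff torusSlabRP_of_tendsto)
open Summit.QuantumFields.YangMills.Cruxes.LatticeGapOnTrajectory.OrbitKantorovichFiniteSize.Transfer
  (UniformSlabClustering)
open Summit.QuantumFields.YangMills.Theorems.ContinuumLegGivenGap
  (exists_subseq_convProducts_of_uuvb stub_asympCS stub_smallRotation stub_bddSlabDensity stub_uclOfCscl)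

/-! ## §1 Stubs — the ONLY six `sorry`s of the file -/
/-- **Stub 1 `stub_mixingTransfer` — the IR leg: the mass-renormalised scheme (∃; L–XL, plausibly provable
strong-mixing bookkeeping).** From the crux's hypotheses (strong exponential decay of the Wilson DLR kernels along
`b_k → ∞` for SOME admissible rates, and EVERY admissible rate sequence tending to `0`) build a sequential scheme `sch`
and `Δ > 0`, `C` with: couplings a subsequence of `b` (so `β_k → ∞`, `HasWeakCouplingLimit`); polynomially growing
volumes (free: `L_k` is chosen here); MASS RENORMALISATION — `Δ·a_k` IS an admissible strong rate at `β_k` (the spacing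
is at most the strong mixing length over `Δ`) and `C·Δ·a_k` is NOT a decay rate (near-sharp choice of the rate: the
spacing is comparable to the strong mixing length; `a_k → 0` is exactly the softening hypothesis); the volume-uniform
lattice gap clause `HasLatticeMassGap r sch Δ` (strong ⇒ torus clustering of every pair of gauge-invariant local
observables at the strong rate, uniformly in the volume); and uniform sup-norm slab clustering of OS pairings on the
scheme's own tori at physical rate `Δ` (`Transfer.UniformSlabClustering`, cluster-expansion format with a prefactor
polynomial in `a_k⁻¹ (w+1)(L_k+1)` — the satisfiable lattice currency; strong mixing with arbitrary boundary
conditions ⇒ covariance bounds for bounded slab observables). No UV bound, no convergence, no positivity is claimed. -/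
theorem stub_mixingTransfer :
    ∀ (G : Type) [Group G] [TopologicalSpace G] [IsTopologicalGroup G] [CompactSpace G]
      [MeasurableSpace G] [BorelSpace G], IsCompactSimpleLieGroup G →
      ∀ (r : LatticeRep G) (b : ℕ → ℝ), Filter.Tendsto b Filter.atTop Filter.atTop →
        (∃ m : ℕ → ℝ, ∀ k, 0 < m k ∧ m k ≤ 1 ∧
          (∀ (M : ℕ) (v : Fin 4 → ℤ) (Λ : Finset (Literature.MathematicalPhysics.QuantumLattice.ZdEdge 4))
            (η : Literature.MathematicalPhysics.QuantumLattice.LGConfig 4 G) (e₁ e₂ : Literature.MathematicalPhysics.QuantumLattice.ZdEdge 4)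
            (f g : Literature.MathematicalPhysics.QuantumLattice.LGConfig 4 G → ℝ),
            Λ = (((Fintype.piFinset fun j : Fin 4 => Finset.Icc (v j) (v j + M)) ×ˢ
              (Finset.univ : Finset (Fin 4))).filter fun e =>
                e.1 e.2 + 1 ≤ v e.2 + M ∧ ∀ j, j ≠ e.2 → v j < e.1 j ∧ e.1 j < v j + M) →
            (∀ j, v j ≤ e₁.1 j ∧ e₁.1 j ≤ v j + M) → e₁.1 e₁.2 + 1 ≤ v e₁.2 + M →
            (∀ j, v j ≤ e₂.1 j ∧ e₂.1 j ≤ v j + M) → e₂.1 e₂.2 + 1 ≤ v e₂.2 + M →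
            Measurable f → Measurable g →
            Literature.MathematicalPhysics.QuantumLattice.IsCylinder f
              ((Literature.MathematicalPhysics.QuantumLattice.plaquettesTouching {e₁}).biUnion
                Literature.MathematicalPhysics.QuantumLattice.plaquetteEdges) →
            Literature.MathematicalPhysics.QuantumLattice.IsCylinder g
              ((Literature.MathematicalPhysics.QuantumLattice.plaquettesTouching {e₂}).biUnion
                Literature.MathematicalPhysics.QuantumLattice.plaquetteEdges) →
            (∀ U, |f U| ≤ 1) → (∀ U, |g U| ≤ 1) →
            |(∫ U, f U * g U ∂(Literature.MathematicalPhysics.QuantumLattice.ymSpecification (d := 4) r.ρ (b k) Λ η)) -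
                (∫ U, f U ∂(Literature.MathematicalPhysics.QuantumLattice.ymSpecification (d := 4) r.ρ (b k) Λ η)) *
                  (∫ U, g U ∂(Literature.MathematicalPhysics.QuantumLattice.ymSpecification (d := 4) r.ρ (b k) Λ η))| ≤
              4 * Real.exp (-((m k) * ‖e₁.1 - e₂.1‖)))) →
        (∀ m : ℕ → ℝ, (∀ k, 0 < m k ∧ m k ≤ 1 ∧
          (∀ (M : ℕ) (v : Fin 4 → ℤ) (Λ : Finset (Literature.MathematicalPhysics.QuantumLattice.ZdEdge 4))
            (η : Literature.MathematicalPhysics.QuantumLattice.LGConfig 4 G) (e₁ e₂ : Literature.MathematicalPhysics.QuantumLattice.ZdEdge 4)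
            (f g : Literature.MathematicalPhysics.QuantumLattice.LGConfig 4 G → ℝ),
            Λ = (((Fintype.piFinset fun j : Fin 4 => Finset.Icc (v j) (v j + M)) ×ˢ
              (Finset.univ : Finset (Fin 4))).filter fun e =>
                e.1 e.2 + 1 ≤ v e.2 + M ∧ ∀ j, j ≠ e.2 → v j < e.1 j ∧ e.1 j < v j + M) →
            (∀ j, v j ≤ e₁.1 j ∧ e₁.1 j ≤ v j + M) → e₁.1 e₁.2 + 1 ≤ v e₁.2 + M →
            (∀ j, v j ≤ e₂.1 j ∧ e₂.1 j ≤ v j + M) → e₂.1 e₂.2 + 1 ≤ v e₂.2 + M →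
            Measurable f → Measurable g →
            Literature.MathematicalPhysics.QuantumLattice.IsCylinder f
              ((Literature.MathematicalPhysics.QuantumLattice.plaquettesTouching {e₁}).biUnion
                Literature.MathematicalPhysics.QuantumLattice.plaquetteEdges) →
            Literature.MathematicalPhysics.QuantumLattice.IsCylinder g
              ((Literature.MathematicalPhysics.QuantumLattice.plaquettesTouching {e₂}).biUnion
                Literature.MathematicalPhysics.QuantumLattice.plaquetteEdges) →
            (∀ U, |f U| ≤ 1) → (∀ U, |g U| ≤ 1) →
            |(∫ U, f U * g U ∂(Literature.MathematicalPhysics.QuantumLattice.ymSpecification (d := 4) r.ρ (b k) Λ η)) -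
                (∫ U, f U ∂(Literature.MathematicalPhysics.QuantumLattice.ymSpecification (d := 4) r.ρ (b k) Λ η)) *
                  (∫ U, g U ∂(Literature.MathematicalPhysics.QuantumLattice.ymSpecification (d := 4) r.ρ (b k) Λ η))| ≤
              4 * Real.exp (-((m k) * ‖e₁.1 - e₂.1‖)))) →
          Filter.Tendsto m Filter.atTop (nhds 0)) →
        ∃ (sch : SpeciesScheme (YMSpecies G)) (Δ C : ℝ), 0 < Δ ∧ sch.HasWeakCouplingLimit ∧
          (∃ φ : ℕ → ℕ, StrictMono φ ∧ ∀ k, sch.β k = b (φ k)) ∧ PolyVolumeGrowth sch ∧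
          (∀ k, Δ * sch.a k ≤ 1 ∧
          (∀ (M : ℕ) (v : Fin 4 → ℤ) (Λ : Finset (Literature.MathematicalPhysics.QuantumLattice.ZdEdge 4))
            (η : Literature.MathematicalPhysics.QuantumLattice.LGConfig 4 G) (e₁ e₂ : Literature.MathematicalPhysics.QuantumLattice.ZdEdge 4)
            (f g : Literature.MathematicalPhysics.QuantumLattice.LGConfig 4 G → ℝ),
            Λ = (((Fintype.piFinset fun j : Fin 4 => Finset.Icc (v j) (v j + M)) ×ˢ
              (Finset.univ : Finset (Fin 4))).filter fun e =>
                e.1 e.2 + 1 ≤ v e.2 + M ∧ ∀ j, j ≠ e.2 → v j < e.1 j ∧ e.1 j < v j + M) →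
            (∀ j, v j ≤ e₁.1 j ∧ e₁.1 j ≤ v j + M) → e₁.1 e₁.2 + 1 ≤ v e₁.2 + M →
            (∀ j, v j ≤ e₂.1 j ∧ e₂.1 j ≤ v j + M) → e₂.1 e₂.2 + 1 ≤ v e₂.2 + M →
            Measurable f → Measurable g →
            Literature.MathematicalPhysics.QuantumLattice.IsCylinder f
              ((Literature.MathematicalPhysics.QuantumLattice.plaquettesTouching {e₁}).biUnion
                Literature.MathematicalPhysics.QuantumLattice.plaquetteEdges) →
            Literature.MathematicalPhysics.QuantumLattice.IsCylinder g
              ((Literature.MathematicalPhysics.QuantumLattice.plaquettesTouching {e₂}).biUnion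
                Literature.MathematicalPhysics.QuantumLattice.plaquetteEdges) →
            (∀ U, |f U| ≤ 1) → (∀ U, |g U| ≤ 1) →
            |(∫ U, f U * g U ∂(Literature.MathematicalPhysics.QuantumLattice.ymSpecification (d := 4) r.ρ (sch.β k) Λ η)) -
                (∫ U, f U ∂(Literature.MathematicalPhysics.QuantumLattice.ymSpecification (d := 4) r.ρ (sch.β k) Λ η)) *
                  (∫ U, g U ∂(Literature.MathematicalPhysics.QuantumLattice.ymSpecification (d := 4) r.ρ (sch.β k) Λ η))| ≤
              4 * Real.exp (-((Δ * sch.a k) * ‖e₁.1 - e₂.1‖)))) ∧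
          (∀ k, ¬ (∀ (M : ℕ) (v : Fin 4 → ℤ) (Λ : Finset (Literature.MathematicalPhysics.QuantumLattice.ZdEdge 4))
            (η : Literature.MathematicalPhysics.QuantumLattice.LGConfig 4 G) (e₁ e₂ : Literature.MathematicalPhysics.QuantumLattice.ZdEdge 4)
            (f g : Literature.MathematicalPhysics.QuantumLattice.LGConfig 4 G → ℝ),
            Λ = (((Fintype.piFinset fun j : Fin 4 => Finset.Icc (v j) (v j + M)) ×ˢ
              (Finset.univ : Finset (Fin 4))).filter fun e =>
                e.1 e.2 + 1 ≤ v e.2 + M ∧ ∀ j, j ≠ e.2 → v j < e.1 j ∧ e.1 j < v j + M) →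
            (∀ j, v j ≤ e₁.1 j ∧ e₁.1 j ≤ v j + M) → e₁.1 e₁.2 + 1 ≤ v e₁.2 + M →
            (∀ j, v j ≤ e₂.1 j ∧ e₂.1 j ≤ v j + M) → e₂.1 e₂.2 + 1 ≤ v e₂.2 + M →
            Measurable f → Measurable g →
            Literature.MathematicalPhysics.QuantumLattice.IsCylinder f
              ((Literature.MathematicalPhysics.QuantumLattice.plaquettesTouching {e₁}).biUnion
                Literature.MathematicalPhysics.QuantumLattice.plaquetteEdges) →
            Literature.MathematicalPhysics.QuantumLattice.IsCylinder g
              ((Literature.MathematicalPhysics.QuantumLattice.plaquettesTouching {e₂}).biUnion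
                Literature.MathematicalPhysics.QuantumLattice.plaquetteEdges) →
            (∀ U, |f U| ≤ 1) → (∀ U, |g U| ≤ 1) →
            |(∫ U, f U * g U ∂(Literature.MathematicalPhysics.QuantumLattice.ymSpecification (d := 4) r.ρ (sch.β k) Λ η)) -
                (∫ U, f U ∂(Literature.MathematicalPhysics.QuantumLattice.ymSpecification (d := 4) r.ρ (sch.β k) Λ η)) *
                  (∫ U, g U ∂(Literature.MathematicalPhysics.QuantumLattice.ymSpecification (d := 4) r.ρ (sch.β k) Λ η))| ≤
              4 * Real.exp (-((C * Δ * sch.a k) * ‖e₁.1 - e₂.1‖)))) ∧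
          HasLatticeMassGap r sch Δ ∧ UniformSlabClustering r sch Δ := by
  sorry

/-- **Stub 2 `stub_csClusteringTransfer` — sup-norm slab clustering ⇒ Cauchy–Schwarz clustering in OS currency
(∀; L, lattice kinematics + reflection positivity, believed provable).** For a weak-coupling scheme (odd-torus
reflection positivity, `torusSlabRP_of_tendsto`) with polynomial volume growth and the uniform-threshold
plaquette-string bounds `UUVB`, uniform sup-norm slab clustering at physical rate `Δ` upgrades to Literature
`SpeciesScheme.HasCSClustering r (canon r sch) Δ'` for some `Δ' > 0` (the canonically renormalised smeared curvature
products of slab-ordered data are slab observables up to Schwartz tails controlled by `UUVB`; the Hankel /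
log-convexity chord of the reflection-positive time correlation interpolates between the OS norm at `t = 0` and the
sup-norm far bound, with loss → 1 under volume growth; the time-chirality of the corner density costs `O(a_k)`
difference quotients, again by `UUVB`). Parallel to route ConvexGribovBody's `stub_csclOfLock` chain, with a
slab-clustering input in place of the per-pair lock. -/
theorem stub_csClusteringTransfer :
    ∀ (G : Type) [Group G] [TopologicalSpace G] [IsTopologicalGroup G] [CompactSpace G]
      [MeasurableSpace G] [BorelSpace G] (r : LatticeRep G) (sch : SpeciesScheme (YMSpecies G)) (Δ : ℝ),
      0 < Δ → sch.HasWeakCouplingLimit → PolyVolumeGrowth sch → UUVB r sch → UniformSlabClustering r sch Δ →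
        ∃ Δ' : ℝ, 0 < Δ' ∧ SpeciesScheme.HasCSClustering r (canon r sch) Δ' := by
  sorry

/-- **Stub 3 `stub_uniformUVBounds` — E0′ at weak coupling (∀; open, UV).** Along every weak-coupling scheme with
polynomially growing volumes, the canonically normalised (`a_k⁻⁴`, torus-mean centred) plaquette strings obey ONE
Schwartz-norm bound with ONE threshold in `k` on all off-diagonal test functions (`UUVB`): dimension-four scaling of the
truncated plaquette correlations inside the correlation length (asymptotic freedom), Schwartz off-diagonal vanishing at
coincidences, and — the reason for the volume clause — negligibility of the torus seam (PT seam report: seam-free iff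
the physical volume grows like a power of `a_k⁻¹`). Tightness for the compactness extraction and the `k`-uniform E0′
input of the packaging both come from here. -/
theorem stub_uniformUVBounds :
    ∀ (G : Type) [Group G] [TopologicalSpace G] [IsTopologicalGroup G] [CompactSpace G]
      [MeasurableSpace G] [BorelSpace G], IsCompactSimpleLieGroup G →
      ∀ (r : LatticeRep G) (sch : SpeciesScheme (YMSpecies G)),
        sch.HasWeakCouplingLimit → PolyVolumeGrowth sch → UUVB r sch := by
  sorry

/-- **Stub 4 `stub_rotationRestoration` — the E1 burden (∀; open).** Along every weak-coupling, polynomially growing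
Wilson sequence whose canonical curvature functions converge on products with uniform plaquette-string bounds, proper
rotations change the canonical curvature distributions by `o(1)` (`AsympRot`): O(4) invariance of the limit functional
(empty when the limit is `0`, rotation restoration at the confinement scale otherwise). Same statement as the E1 stub of
the sibling birth skeleton of `OneCertifiedCube.ContinuumLimitExists` — one proof serves both. -/
theorem stub_rotationRestoration :
    ∀ (G : Type) [Group G] [TopologicalSpace G] [IsTopologicalGroup G] [CompactSpace G]
      [MeasurableSpace G] [BorelSpace G], IsCompactSimpleLieGroup G →
      ∀ (r : LatticeRep G) (sch : SpeciesScheme (YMSpecies G)),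
        sch.HasWeakCouplingLimit → PolyVolumeGrowth sch → ConvProducts r sch → UUVB r sch →
          AsympRot r sch := by
  sorry

/-- **Stub 5 `stub_scaleComparability` — `ξ_strong ≍ ξ_bulk` (∀; open, the route's named risk).** For a compact simple
`G` and a weak-coupling scheme whose spacing is two-sidedly pinned to the STRONG (boundary-uniform) mixing length
(`Δ·a_k` an admissible strong rate, `C·Δ·a_k` not a decay rate), the BULK (torus) correlation length is comparable:
for some `Δ₂ > 0`, eventually in `k`, on arbitrarily large tori some pair of gauge-invariant local observables has
time correlations NOT `O(e^{−Δ₂ a_k n})` — the torus physical mass stays below `Δ₂`, i.e. no boundary layer orders at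
a scale parametrically longer than the bulk correlation length. If this fails, the mass-renormalised limit is
ultralocal (barrier `FixedCouplingUltralocality`) and the crux's conclusion cannot be reached at this scale. -/
theorem stub_scaleComparability :
    ∀ (G : Type) [Group G] [TopologicalSpace G] [IsTopologicalGroup G] [CompactSpace G]
      [MeasurableSpace G] [BorelSpace G], IsCompactSimpleLieGroup G →
      ∀ (r : LatticeRep G) (sch : SpeciesScheme (YMSpecies G)) (Δ C : ℝ), 0 < Δ → sch.HasWeakCouplingLimit →
        (∀ k, Δ * sch.a k ≤ 1 ∧
          (∀ (M : ℕ) (v : Fin 4 → ℤ) (Λ : Finset (Literature.MathematicalPhysics.QuantumLattice.ZdEdge 4))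
            (η : Literature.MathematicalPhysics.QuantumLattice.LGConfig 4 G) (e₁ e₂ : Literature.MathematicalPhysics.QuantumLattice.ZdEdge 4)
            (f g : Literature.MathematicalPhysics.QuantumLattice.LGConfig 4 G → ℝ),
            Λ = (((Fintype.piFinset fun j : Fin 4 => Finset.Icc (v j) (v j + M)) ×ˢ
              (Finset.univ : Finset (Fin 4))).filter fun e =>
                e.1 e.2 + 1 ≤ v e.2 + M ∧ ∀ j, j ≠ e.2 → v j < e.1 j ∧ e.1 j < v j + M) →
            (∀ j, v j ≤ e₁.1 j ∧ e₁.1 j ≤ v j + M) → e₁.1 e₁.2 + 1 ≤ v e₁.2 + M →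
            (∀ j, v j ≤ e₂.1 j ∧ e₂.1 j ≤ v j + M) → e₂.1 e₂.2 + 1 ≤ v e₂.2 + M →
            Measurable f → Measurable g →
            Literature.MathematicalPhysics.QuantumLattice.IsCylinder f
              ((Literature.MathematicalPhysics.QuantumLattice.plaquettesTouching {e₁}).biUnion
                Literature.MathematicalPhysics.QuantumLattice.plaquetteEdges) →
            Literature.MathematicalPhysics.QuantumLattice.IsCylinder g
              ((Literature.MathematicalPhysics.QuantumLattice.plaquettesTouching {e₂}).biUnion
                Literature.MathematicalPhysics.QuantumLattice.plaquetteEdges) →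
            (∀ U, |f U| ≤ 1) → (∀ U, |g U| ≤ 1) →
            |(∫ U, f U * g U ∂(Literature.MathematicalPhysics.QuantumLattice.ymSpecification (d := 4) r.ρ (sch.β k) Λ η)) -
                (∫ U, f U ∂(Literature.MathematicalPhysics.QuantumLattice.ymSpecification (d := 4) r.ρ (sch.β k) Λ η)) *
                  (∫ U, g U ∂(Literature.MathematicalPhysics.QuantumLattice.ymSpecification (d := 4) r.ρ (sch.β k) Λ η))| ≤
              4 * Real.exp (-((Δ * sch.a k) * ‖e₁.1 - e₂.1‖)))) →
        (∀ k, ¬ (∀ (M : ℕ) (v : Fin 4 → ℤ) (Λ : Finset (Literature.MathematicalPhysics.QuantumLattice.ZdEdge 4))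
            (η : Literature.MathematicalPhysics.QuantumLattice.LGConfig 4 G) (e₁ e₂ : Literature.MathematicalPhysics.QuantumLattice.ZdEdge 4)
            (f g : Literature.MathematicalPhysics.QuantumLattice.LGConfig 4 G → ℝ),
            Λ = (((Fintype.piFinset fun j : Fin 4 => Finset.Icc (v j) (v j + M)) ×ˢ
              (Finset.univ : Finset (Fin 4))).filter fun e =>
                e.1 e.2 + 1 ≤ v e.2 + M ∧ ∀ j, j ≠ e.2 → v j < e.1 j ∧ e.1 j < v j + M) →
            (∀ j, v j ≤ e₁.1 j ∧ e₁.1 j ≤ v j + M) → e₁.1 e₁.2 + 1 ≤ v e₁.2 + M →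
            (∀ j, v j ≤ e₂.1 j ∧ e₂.1 j ≤ v j + M) → e₂.1 e₂.2 + 1 ≤ v e₂.2 + M →
            Measurable f → Measurable g →
            Literature.MathematicalPhysics.QuantumLattice.IsCylinder f
              ((Literature.MathematicalPhysics.QuantumLattice.plaquettesTouching {e₁}).biUnion
                Literature.MathematicalPhysics.QuantumLattice.plaquetteEdges) →
            Literature.MathematicalPhysics.QuantumLattice.IsCylinder g
              ((Literature.MathematicalPhysics.QuantumLattice.plaquettesTouching {e₂}).biUnion
                Literature.MathematicalPhysics.QuantumLattice.plaquetteEdges) →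
            (∀ U, |f U| ≤ 1) → (∀ U, |g U| ≤ 1) →
            |(∫ U, f U * g U ∂(Literature.MathematicalPhysics.QuantumLattice.ymSpecification (d := 4) r.ρ (sch.β k) Λ η)) -
                (∫ U, f U ∂(Literature.MathematicalPhysics.QuantumLattice.ymSpecification (d := 4) r.ρ (sch.β k) Λ η)) *
                  (∫ U, g U ∂(Literature.MathematicalPhysics.QuantumLattice.ymSpecification (d := 4) r.ρ (sch.β k) Λ η))| ≤
              4 * Real.exp (-((C * Δ * sch.a k) * ‖e₁.1 - e₂.1‖)))) →
        ∃ Δ₂ : ℝ, 0 < Δ₂ ∧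
        (∀ᶠ k in Filter.atTop, ∀ S₀ : ℕ, ∃ A B : YMSpecies G, ∀ C' : ℝ, ∃ S n : ℕ, S₀ ≤ S ∧ n ≤ S ∧
          C' * Real.exp (-(Δ₂ * (sch.a k * n))) <
            |latticeConnectedCorr r.ρ (sch.β k) (2 * S + 1) A.F B.F n|) := by
  sorry

/-- **Stub 6 `stub_nonDegenerateCurvature` — non-trivial, non-Gaussian `tr F²` at the pinned scale (∀; open).** For a
compact simple `G` and a weak-coupling scheme whose BULK correlation length is pinned two-sidedly in physical units
(`HasLatticeMassGap r sch Δ` from above, the bulk pin at rate `Δ₂` from below) and whose canonical plaquette strings obey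
`UUVB`, the canonically normalised curvature field has a non-degenerate truncated two-point limit (`ND2`, the
`IsNontrivial` witness: the plaquette is `a⁴ g² tr F²` to leading order, the RG-invariant trace-anomaly combination,
so `c = a⁻⁴` is the right normalisation up to `1 + O(g²)`) and a non-degenerate three-point limit (`ND3`, the
`IsNonGaussian` witness), eventually in `k`. A Gaussian or ultralocal scaling limit at the confinement scale refutes it
(kill target: `φ⁴₄`-type triviality, barrier `ScalarPhi4Triviality`). -/
theorem stub_nonDegenerateCurvature :
    ∀ (G : Type) [Group G] [TopologicalSpace G] [IsTopologicalGroup G] [CompactSpace G]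
      [MeasurableSpace G] [BorelSpace G], IsCompactSimpleLieGroup G →
      ∀ (r : LatticeRep G) (sch : SpeciesScheme (YMSpecies G)) (Δ Δ₂ : ℝ), 0 < Δ → 0 < Δ₂ →
        sch.HasWeakCouplingLimit → HasLatticeMassGap r sch Δ →
        (∀ᶠ k in Filter.atTop, ∀ S₀ : ℕ, ∃ A B : YMSpecies G, ∀ C' : ℝ, ∃ S n : ℕ, S₀ ≤ S ∧ n ≤ S ∧
          C' * Real.exp (-(Δ₂ * (sch.a k * n))) <
            |latticeConnectedCorr r.ρ (sch.β k) (2 * S + 1) A.F B.F n|) →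
        UUVB r sch → ND2 r sch ∧ ND3 r sch := by
  sorry


/-! ## §2 Glue (proved): monotonicity in the rate and transport along sub-schemes -/

section Glue

variable {G : Type} [Group G] [TopologicalSpace G] [IsTopologicalGroup G] [CompactSpace G]
  [MeasurableSpace G] [BorelSpace G]

/-- The lattice gap clause is antitone in the rate. -/
theorem hasLatticeMassGap_mono (r : LatticeRep G) (sch : SpeciesScheme (YMSpecies G)) {Δ Δ' : ℝ}
    (hΔ : Δ' ≤ Δ) (h : HasLatticeMassGap r sch Δ) : HasLatticeMassGap r sch Δ' := by
  intro A B
  obtain ⟨C, hC⟩ := h A B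
  refine ⟨max C 0, hC.mono fun k hk S hS n hn => (hk S hS n hn).trans ?_⟩
  have h1 : Real.exp (-(Δ * (sch.a k * n))) ≤ Real.exp (-(Δ' * (sch.a k * n))) :=
    Real.exp_le_exp.2 (neg_le_neg (mul_le_mul_of_nonneg_right hΔ
      (mul_nonneg (sch.a_pos k).le (Nat.cast_nonneg n))))
  calc C * Real.exp (-(Δ * (sch.a k * n))) ≤ max C 0 * Real.exp (-(Δ * (sch.a k * n))) :=
        mul_le_mul_of_nonneg_right (le_max_left _ _) (Real.exp_pos _).le
    _ ≤ max C 0 * Real.exp (-(Δ' * (sch.a k * n))) := mul_le_mul_of_nonneg_left h1 (le_max_right _ _)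

/-- Cauchy–Schwarz clustering is antitone in the rate. -/
theorem hasCSClustering_mono (r : LatticeRep G) (sch : SpeciesScheme (YMSpecies G)) {Δ Δ' : ℝ} (hΔ : Δ' ≤ Δ)
    (h : SpeciesScheme.HasCSClustering r sch Δ) : SpeciesScheme.HasCSClustering r sch Δ' := by
  intro n m hn hm σ σ' N N' c c' p q hp hq t ht ε hε
  refine (h n m hn hm σ σ' N N' c c' p q hp hq t ht ε hε).mono fun k hk => hk.trans ?_
  have h1 : Real.exp (-Δ * t) ≤ Real.exp (-Δ' * t) := Real.exp_le_exp.2 (by nlinarith)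
  gcongr

/-- Cauchy–Schwarz clustering of the canonical scheme rides along sub-schemes (every clause is `∀ᶠ k`; the lattice
Schwinger functions of `canon r (subScheme sch ψ hψ)` at step `k` are those of `canon r sch` at step `ψ k`, definitionally). -/
theorem hasCSClustering_canon_subScheme (r : LatticeRep G) (sch : SpeciesScheme (YMSpecies G)) (ψ : ℕ → ℕ)
    (hψ : StrictMono ψ) {Δ : ℝ} (h : SpeciesScheme.HasCSClustering r (canon r sch) Δ) :
    SpeciesScheme.HasCSClustering r (canon r (subScheme sch ψ hψ)) Δ := by
  intro n m hn hm σ σ' N N' c c' p q hp hq t ht ε hε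
  exact hψ.tendsto_atTop.eventually (h n m hn hm σ σ' N N' c c' p q hp hq t ht ε hε)

/-- Polynomial volume growth rides along sub-schemes. -/
theorem polyVolumeGrowth_subScheme {ι : Type} (sch : SpeciesScheme ι) (ψ : ℕ → ℕ) (hψ : StrictMono ψ)
    (h : PolyVolumeGrowth sch) : PolyVolumeGrowth (subScheme sch ψ hψ) := by
  obtain ⟨N, hN, hev⟩ := h
  exact ⟨N, hN, hψ.tendsto_atTop.eventually hev⟩

/-- The canonical string distributions of a sub-scheme are those of the scheme, reindexed (definitional). -/
theorem canonDistribution_subScheme (r : LatticeRep G) (sch : SpeciesScheme (YMSpecies G)) (ψ : ℕ → ℕ)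
    (hψ : StrictMono ψ) (k p : ℕ) (σ : Fin p → YMSpecies G) (F : 𝓢((Fin p → EuclideanSpace ℝ (Fin 4)), ℂ)) :
    canonDistribution r (subScheme sch ψ hψ) k p σ F = canonDistribution r sch (ψ k) p σ F :=
  rfl

/-- The canonical curvature distributions of a sub-scheme are those of the scheme, reindexed (definitional). -/
theorem curvDistribution_subScheme (r : LatticeRep G) (sch : SpeciesScheme (YMSpecies G)) (ψ : ℕ → ℕ)
    (hψ : StrictMono ψ) (k p : ℕ) (F : 𝓢((Fin p → EuclideanSpace ℝ (Fin 4)), ℂ)) :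
    curvDistribution r (subScheme sch ψ hψ) k p F = curvDistribution r sch (ψ k) p F :=
  rfl

/-- The uniform-threshold plaquette-string bounds ride along sub-schemes. -/
theorem uuvb_subScheme (r : LatticeRep G) (sch : SpeciesScheme (YMSpecies G)) (ψ : ℕ → ℕ) (hψ : StrictMono ψ)
    (h : UUVB r sch) : UUVB r (subScheme sch ψ hψ) := by
  obtain ⟨s, α, β', hev⟩ := h
  refine ⟨s, α, β', (hψ.tendsto_atTop.eventually hev).mono fun k hk p q F hF => ?_⟩
  rw [canonDistribution_subScheme]
  exact hk p q F hF

/-- The two-point floor rides along sub-schemes. -/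
theorem nd2_subScheme (r : LatticeRep G) (sch : SpeciesScheme (YMSpecies G)) (ψ : ℕ → ℕ) (hψ : StrictMono ψ)
    (h : ND2 r sch) : ND2 r (subScheme sch ψ hψ) := by
  obtain ⟨F, G₁, H, hF, hG₁, hH, δ, hδ, hev⟩ := h
  refine ⟨F, G₁, H, hF, hG₁, hH, δ, hδ, (hψ.tendsto_atTop.eventually hev).mono fun k hk => ?_⟩
  rw [curvDistribution_subScheme]
  exact hk

/-- The three-point floor rides along sub-schemes. -/
theorem nd3_subScheme (r : LatticeRep G) (sch : SpeciesScheme (YMSpecies G)) (ψ : ℕ → ℕ) (hψ : StrictMono ψ)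
    (h : ND3 r sch) : ND3 r (subScheme sch ψ hψ) := by
  obtain ⟨f, g, h₃, F₃, hT, hO, δ, hδ, hev⟩ := h
  refine ⟨f, g, h₃, F₃, hT, hO, δ, hδ, (hψ.tendsto_atTop.eventually hev).mono fun k hk => ?_⟩
  rw [curvDistribution_subScheme]
  exact hk

end Glue

/-! ## §3 Composition — sorry-free glue; concludes the route decl BY NAME -/

/-- **The glue alone, `sorry`-free**: the six stub STATEMENTS (verbatim) imply the crux BY NAME. This theorem does
not mention the stubs (its axiom closure is `propext`, `Classical.choice`, `Quot.sound`). -/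
theorem compose
    (h₁ : ∀ (G : Type) [Group G] [TopologicalSpace G] [IsTopologicalGroup G] [CompactSpace G]
        [MeasurableSpace G] [BorelSpace G], IsCompactSimpleLieGroup G →
        ∀ (r : LatticeRep G) (b : ℕ → ℝ), Filter.Tendsto b Filter.atTop Filter.atTop →
          (∃ m : ℕ → ℝ, ∀ k, 0 < m k ∧ m k ≤ 1 ∧
            (∀ (M : ℕ) (v : Fin 4 → ℤ) (Λ : Finset (Literature.MathematicalPhysics.QuantumLattice.ZdEdge 4))
              (η : Literature.MathematicalPhysics.QuantumLattice.LGConfig 4 G) (e₁ e₂ : Literature.MathematicalPhysics.QuantumLattice.ZdEdge 4)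
              (f g : Literature.MathematicalPhysics.QuantumLattice.LGConfig 4 G → ℝ),
              Λ = (((Fintype.piFinset fun j : Fin 4 => Finset.Icc (v j) (v j + M)) ×ˢ
                (Finset.univ : Finset (Fin 4))).filter fun e =>
                  e.1 e.2 + 1 ≤ v e.2 + M ∧ ∀ j, j ≠ e.2 → v j < e.1 j ∧ e.1 j < v j + M) →
              (∀ j, v j ≤ e₁.1 j ∧ e₁.1 j ≤ v j + M) → e₁.1 e₁.2 + 1 ≤ v e₁.2 + M →
              (∀ j, v j ≤ e₂.1 j ∧ e₂.1 j ≤ v j + M) → e₂.1 e₂.2 + 1 ≤ v e₂.2 + M →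
              Measurable f → Measurable g →
              Literature.MathematicalPhysics.QuantumLattice.IsCylinder f
                ((Literature.MathematicalPhysics.QuantumLattice.plaquettesTouching {e₁}).biUnion
                  Literature.MathematicalPhysics.QuantumLattice.plaquetteEdges) →
              Literature.MathematicalPhysics.QuantumLattice.IsCylinder g
                ((Literature.MathematicalPhysics.QuantumLattice.plaquettesTouching {e₂}).biUnion
                  Literature.MathematicalPhysics.QuantumLattice.plaquetteEdges) →
              (∀ U, |f U| ≤ 1) → (∀ U, |g U| ≤ 1) →
              |(∫ U, f U * g U ∂(Literature.MathematicalPhysics.QuantumLattice.ymSpecification (d := 4) r.ρ (b k) Λ η)) -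
                  (∫ U, f U ∂(Literature.MathematicalPhysics.QuantumLattice.ymSpecification (d := 4) r.ρ (b k) Λ η)) *
                    (∫ U, g U ∂(Literature.MathematicalPhysics.QuantumLattice.ymSpecification (d := 4) r.ρ (b k) Λ η))| ≤
                4 * Real.exp (-((m k) * ‖e₁.1 - e₂.1‖)))) →
          (∀ m : ℕ → ℝ, (∀ k, 0 < m k ∧ m k ≤ 1 ∧
            (∀ (M : ℕ) (v : Fin 4 → ℤ) (Λ : Finset (Literature.MathematicalPhysics.QuantumLattice.ZdEdge 4))
              (η : Literature.MathematicalPhysics.QuantumLattice.LGConfig 4 G) (e₁ e₂ : Literature.MathematicalPhysics.QuantumLattice.ZdEdge 4)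
              (f g : Literature.MathematicalPhysics.QuantumLattice.LGConfig 4 G → ℝ),
              Λ = (((Fintype.piFinset fun j : Fin 4 => Finset.Icc (v j) (v j + M)) ×ˢ
                (Finset.univ : Finset (Fin 4))).filter fun e =>
                  e.1 e.2 + 1 ≤ v e.2 + M ∧ ∀ j, j ≠ e.2 → v j < e.1 j ∧ e.1 j < v j + M) →
              (∀ j, v j ≤ e₁.1 j ∧ e₁.1 j ≤ v j + M) → e₁.1 e₁.2 + 1 ≤ v e₁.2 + M →
              (∀ j, v j ≤ e₂.1 j ∧ e₂.1 j ≤ v j + M) → e₂.1 e₂.2 + 1 ≤ v e₂.2 + M →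
              Measurable f → Measurable g →
              Literature.MathematicalPhysics.QuantumLattice.IsCylinder f
                ((Literature.MathematicalPhysics.QuantumLattice.plaquettesTouching {e₁}).biUnion
                  Literature.MathematicalPhysics.QuantumLattice.plaquetteEdges) →
              Literature.MathematicalPhysics.QuantumLattice.IsCylinder g
                ((Literature.MathematicalPhysics.QuantumLattice.plaquettesTouching {e₂}).biUnion
                  Literature.MathematicalPhysics.QuantumLattice.plaquetteEdges) →
              (∀ U, |f U| ≤ 1) → (∀ U, |g U| ≤ 1) →
              |(∫ U, f U * g U ∂(Literature.MathematicalPhysics.QuantumLattice.ymSpecification (d := 4) r.ρ (b k) Λ η)) -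
                  (∫ U, f U ∂(Literature.MathematicalPhysics.QuantumLattice.ymSpecification (d := 4) r.ρ (b k) Λ η)) *
                    (∫ U, g U ∂(Literature.MathematicalPhysics.QuantumLattice.ymSpecification (d := 4) r.ρ (b k) Λ η))| ≤
                4 * Real.exp (-((m k) * ‖e₁.1 - e₂.1‖)))) →
            Filter.Tendsto m Filter.atTop (nhds 0)) →
          ∃ (sch : SpeciesScheme (YMSpecies G)) (Δ C : ℝ), 0 < Δ ∧ sch.HasWeakCouplingLimit ∧
            (∃ φ : ℕ → ℕ, StrictMono φ ∧ ∀ k, sch.β k = b (φ k)) ∧ PolyVolumeGrowth sch ∧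
            (∀ k, Δ * sch.a k ≤ 1 ∧
            (∀ (M : ℕ) (v : Fin 4 → ℤ) (Λ : Finset (Literature.MathematicalPhysics.QuantumLattice.ZdEdge 4))
              (η : Literature.MathematicalPhysics.QuantumLattice.LGConfig 4 G) (e₁ e₂ : Literature.MathematicalPhysics.QuantumLattice.ZdEdge 4)
              (f g : Literature.MathematicalPhysics.QuantumLattice.LGConfig 4 G → ℝ),
              Λ = (((Fintype.piFinset fun j : Fin 4 => Finset.Icc (v j) (v j + M)) ×ˢ
                (Finset.univ : Finset (Fin 4))).filter fun e =>
                  e.1 e.2 + 1 ≤ v e.2 + M ∧ ∀ j, j ≠ e.2 → v j < e.1 j ∧ e.1 j < v j + M) →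
              (∀ j, v j ≤ e₁.1 j ∧ e₁.1 j ≤ v j + M) → e₁.1 e₁.2 + 1 ≤ v e₁.2 + M →
              (∀ j, v j ≤ e₂.1 j ∧ e₂.1 j ≤ v j + M) → e₂.1 e₂.2 + 1 ≤ v e₂.2 + M →
              Measurable f → Measurable g →
              Literature.MathematicalPhysics.QuantumLattice.IsCylinder f
                ((Literature.MathematicalPhysics.QuantumLattice.plaquettesTouching {e₁}).biUnion
                  Literature.MathematicalPhysics.QuantumLattice.plaquetteEdges) →
              Literature.MathematicalPhysics.QuantumLattice.IsCylinder g
                ((Literature.MathematicalPhysics.QuantumLattice.plaquettesTouching {e₂}).biUnion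
                  Literature.MathematicalPhysics.QuantumLattice.plaquetteEdges) →
              (∀ U, |f U| ≤ 1) → (∀ U, |g U| ≤ 1) →
              |(∫ U, f U * g U ∂(Literature.MathematicalPhysics.QuantumLattice.ymSpecification (d := 4) r.ρ (sch.β k) Λ η)) -
                  (∫ U, f U ∂(Literature.MathematicalPhysics.QuantumLattice.ymSpecification (d := 4) r.ρ (sch.β k) Λ η)) *
                    (∫ U, g U ∂(Literature.MathematicalPhysics.QuantumLattice.ymSpecification (d := 4) r.ρ (sch.β k) Λ η))| ≤
                4 * Real.exp (-((Δ * sch.a k) * ‖e₁.1 - e₂.1‖)))) ∧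
            (∀ k, ¬ (∀ (M : ℕ) (v : Fin 4 → ℤ) (Λ : Finset (Literature.MathematicalPhysics.QuantumLattice.ZdEdge 4))
              (η : Literature.MathematicalPhysics.QuantumLattice.LGConfig 4 G) (e₁ e₂ : Literature.MathematicalPhysics.QuantumLattice.ZdEdge 4)
              (f g : Literature.MathematicalPhysics.QuantumLattice.LGConfig 4 G → ℝ),
              Λ = (((Fintype.piFinset fun j : Fin 4 => Finset.Icc (v j) (v j + M)) ×ˢ
                (Finset.univ : Finset (Fin 4))).filter fun e =>
                  e.1 e.2 + 1 ≤ v e.2 + M ∧ ∀ j, j ≠ e.2 → v j < e.1 j ∧ e.1 j < v j + M) →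
              (∀ j, v j ≤ e₁.1 j ∧ e₁.1 j ≤ v j + M) → e₁.1 e₁.2 + 1 ≤ v e₁.2 + M →
              (∀ j, v j ≤ e₂.1 j ∧ e₂.1 j ≤ v j + M) → e₂.1 e₂.2 + 1 ≤ v e₂.2 + M →
              Measurable f → Measurable g →
              Literature.MathematicalPhysics.QuantumLattice.IsCylinder f
                ((Literature.MathematicalPhysics.QuantumLattice.plaquettesTouching {e₁}).biUnion
                  Literature.MathematicalPhysics.QuantumLattice.plaquetteEdges) →
              Literature.MathematicalPhysics.QuantumLattice.IsCylinder g
                ((Literature.MathematicalPhysics.QuantumLattice.plaquettesTouching {e₂}).biUnion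
                  Literature.MathematicalPhysics.QuantumLattice.plaquetteEdges) →
              (∀ U, |f U| ≤ 1) → (∀ U, |g U| ≤ 1) →
              |(∫ U, f U * g U ∂(Literature.MathematicalPhysics.QuantumLattice.ymSpecification (d := 4) r.ρ (sch.β k) Λ η)) -
                  (∫ U, f U ∂(Literature.MathematicalPhysics.QuantumLattice.ymSpecification (d := 4) r.ρ (sch.β k) Λ η)) *
                    (∫ U, g U ∂(Literature.MathematicalPhysics.QuantumLattice.ymSpecification (d := 4) r.ρ (sch.β k) Λ η))| ≤
                4 * Real.exp (-((C * Δ * sch.a k) * ‖e₁.1 - e₂.1‖)))) ∧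
            HasLatticeMassGap r sch Δ ∧ UniformSlabClustering r sch Δ)
    (h₂ : ∀ (G : Type) [Group G] [TopologicalSpace G] [IsTopologicalGroup G] [CompactSpace G]
        [MeasurableSpace G] [BorelSpace G] (r : LatticeRep G) (sch : SpeciesScheme (YMSpecies G)) (Δ : ℝ),
        0 < Δ → sch.HasWeakCouplingLimit → PolyVolumeGrowth sch → UUVB r sch → UniformSlabClustering r sch Δ →
          ∃ Δ' : ℝ, 0 < Δ' ∧ SpeciesScheme.HasCSClustering r (canon r sch) Δ')
    (h₃ : ∀ (G : Type) [Group G] [TopologicalSpace G] [IsTopologicalGroup G] [CompactSpace G]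
        [MeasurableSpace G] [BorelSpace G], IsCompactSimpleLieGroup G →
        ∀ (r : LatticeRep G) (sch : SpeciesScheme (YMSpecies G)),
          sch.HasWeakCouplingLimit → PolyVolumeGrowth sch → UUVB r sch)
    (h₄ : ∀ (G : Type) [Group G] [TopologicalSpace G] [IsTopologicalGroup G] [CompactSpace G]
        [MeasurableSpace G] [BorelSpace G], IsCompactSimpleLieGroup G →
        ∀ (r : LatticeRep G) (sch : SpeciesScheme (YMSpecies G)),
          sch.HasWeakCouplingLimit → PolyVolumeGrowth sch → ConvProducts r sch → UUVB r sch →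
            AsympRot r sch)
    (h₅ : ∀ (G : Type) [Group G] [TopologicalSpace G] [IsTopologicalGroup G] [CompactSpace G]
        [MeasurableSpace G] [BorelSpace G], IsCompactSimpleLieGroup G →
        ∀ (r : LatticeRep G) (sch : SpeciesScheme (YMSpecies G)) (Δ C : ℝ), 0 < Δ → sch.HasWeakCouplingLimit →
          (∀ k, Δ * sch.a k ≤ 1 ∧
            (∀ (M : ℕ) (v : Fin 4 → ℤ) (Λ : Finset (Literature.MathematicalPhysics.QuantumLattice.ZdEdge 4))
              (η : Literature.MathematicalPhysics.QuantumLattice.LGConfig 4 G) (e₁ e₂ : Literature.MathematicalPhysics.QuantumLattice.ZdEdge 4)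
              (f g : Literature.MathematicalPhysics.QuantumLattice.LGConfig 4 G → ℝ),
              Λ = (((Fintype.piFinset fun j : Fin 4 => Finset.Icc (v j) (v j + M)) ×ˢ
                (Finset.univ : Finset (Fin 4))).filter fun e =>
                  e.1 e.2 + 1 ≤ v e.2 + M ∧ ∀ j, j ≠ e.2 → v j < e.1 j ∧ e.1 j < v j + M) →
              (∀ j, v j ≤ e₁.1 j ∧ e₁.1 j ≤ v j + M) → e₁.1 e₁.2 + 1 ≤ v e₁.2 + M →
              (∀ j, v j ≤ e₂.1 j ∧ e₂.1 j ≤ v j + M) → e₂.1 e₂.2 + 1 ≤ v e₂.2 + M →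
              Measurable f → Measurable g →
              Literature.MathematicalPhysics.QuantumLattice.IsCylinder f
                ((Literature.MathematicalPhysics.QuantumLattice.plaquettesTouching {e₁}).biUnion
                  Literature.MathematicalPhysics.QuantumLattice.plaquetteEdges) →
              Literature.MathematicalPhysics.QuantumLattice.IsCylinder g
                ((Literature.MathematicalPhysics.QuantumLattice.plaquettesTouching {e₂}).biUnion
                  Literature.MathematicalPhysics.QuantumLattice.plaquetteEdges) →
              (∀ U, |f U| ≤ 1) → (∀ U, |g U| ≤ 1) →
              |(∫ U, f U * g U ∂(Literature.MathematicalPhysics.QuantumLattice.ymSpecification (d := 4) r.ρ (sch.β k) Λ η)) -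
                  (∫ U, f U ∂(Literature.MathematicalPhysics.QuantumLattice.ymSpecification (d := 4) r.ρ (sch.β k) Λ η)) *
                    (∫ U, g U ∂(Literature.MathematicalPhysics.QuantumLattice.ymSpecification (d := 4) r.ρ (sch.β k) Λ η))| ≤
                4 * Real.exp (-((Δ * sch.a k) * ‖e₁.1 - e₂.1‖)))) →
          (∀ k, ¬ (∀ (M : ℕ) (v : Fin 4 → ℤ) (Λ : Finset (Literature.MathematicalPhysics.QuantumLattice.ZdEdge 4))
              (η : Literature.MathematicalPhysics.QuantumLattice.LGConfig 4 G) (e₁ e₂ : Literature.MathematicalPhysics.QuantumLattice.ZdEdge 4)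
              (f g : Literature.MathematicalPhysics.QuantumLattice.LGConfig 4 G → ℝ),
              Λ = (((Fintype.piFinset fun j : Fin 4 => Finset.Icc (v j) (v j + M)) ×ˢ
                (Finset.univ : Finset (Fin 4))).filter fun e =>
                  e.1 e.2 + 1 ≤ v e.2 + M ∧ ∀ j, j ≠ e.2 → v j < e.1 j ∧ e.1 j < v j + M) →
              (∀ j, v j ≤ e₁.1 j ∧ e₁.1 j ≤ v j + M) → e₁.1 e₁.2 + 1 ≤ v e₁.2 + M →
              (∀ j, v j ≤ e₂.1 j ∧ e₂.1 j ≤ v j + M) → e₂.1 e₂.2 + 1 ≤ v e₂.2 + M →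
              Measurable f → Measurable g →
              Literature.MathematicalPhysics.QuantumLattice.IsCylinder f
                ((Literature.MathematicalPhysics.QuantumLattice.plaquettesTouching {e₁}).biUnion
                  Literature.MathematicalPhysics.QuantumLattice.plaquetteEdges) →
              Literature.MathematicalPhysics.QuantumLattice.IsCylinder g
                ((Literature.MathematicalPhysics.QuantumLattice.plaquettesTouching {e₂}).biUnion
                  Literature.MathematicalPhysics.QuantumLattice.plaquetteEdges) →
              (∀ U, |f U| ≤ 1) → (∀ U, |g U| ≤ 1) →
              |(∫ U, f U * g U ∂(Literature.MathematicalPhysics.QuantumLattice.ymSpecification (d := 4) r.ρ (sch.β k) Λ η)) -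
                  (∫ U, f U ∂(Literature.MathematicalPhysics.QuantumLattice.ymSpecification (d := 4) r.ρ (sch.β k) Λ η)) *
                    (∫ U, g U ∂(Literature.MathematicalPhysics.QuantumLattice.ymSpecification (d := 4) r.ρ (sch.β k) Λ η))| ≤
                4 * Real.exp (-((C * Δ * sch.a k) * ‖e₁.1 - e₂.1‖)))) →
          ∃ Δ₂ : ℝ, 0 < Δ₂ ∧
          (∀ᶠ k in Filter.atTop, ∀ S₀ : ℕ, ∃ A B : YMSpecies G, ∀ C' : ℝ, ∃ S n : ℕ, S₀ ≤ S ∧ n ≤ S ∧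
            C' * Real.exp (-(Δ₂ * (sch.a k * n))) <
              |latticeConnectedCorr r.ρ (sch.β k) (2 * S + 1) A.F B.F n|))
    (h₆ : ∀ (G : Type) [Group G] [TopologicalSpace G] [IsTopologicalGroup G] [CompactSpace G]
        [MeasurableSpace G] [BorelSpace G], IsCompactSimpleLieGroup G →
        ∀ (r : LatticeRep G) (sch : SpeciesScheme (YMSpecies G)) (Δ Δ₂ : ℝ), 0 < Δ → 0 < Δ₂ →
          sch.HasWeakCouplingLimit → HasLatticeMassGap r sch Δ →
          (∀ᶠ k in Filter.atTop, ∀ S₀ : ℕ, ∃ A B : YMSpecies G, ∀ C' : ℝ, ∃ S n : ℕ, S₀ ≤ S ∧ n ≤ S ∧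
            C' * Real.exp (-(Δ₂ * (sch.a k * n))) <
              |latticeConnectedCorr r.ρ (sch.β k) (2 * S + 1) A.F B.F n|) →
          UUVB r sch → ND2 r sch ∧ ND3 r sch) :
    Summit.QuantumFields.YangMills.Theses.ThermalRuler.ContinuumFromMixing := by
  intro G _ _ _ _ hG
  letI : MeasurableSpace G := borel G
  haveI : BorelSpace G := ⟨rfl⟩
  intro r b hb hdec hsoft
  -- Stub 1: the mass-renormalised weak-coupling scheme with the lattice gap and uniform slab clustering
  obtain ⟨sch, Δ, C, hΔ, hW, -, hPVG, hMR, hMRn, hGap, hSlab⟩ := h₁ G hG r b hb hdec hsoft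
  -- Stub 3: uniform-threshold E0′ bounds
  have hUU : UUVB r sch := h₃ G hG r sch hW hPVG
  -- Stub 5: the bulk correlation length is comparable to the strong mixing length
  obtain ⟨Δ₂, hΔ₂, hPin⟩ := h₅ G hG r sch Δ C hΔ hW hMR hMRn
  -- Stub 6: non-degenerate two- and three-point limits of the canonical curvature
  obtain ⟨hND2, hND3⟩ := h₆ G hG r sch Δ Δ₂ hΔ hΔ₂ hW hGap hPin hUU
  -- Stub 2: Cauchy–Schwarz clustering of the canonical scheme in OS currency
  obtain ⟨Δ', hΔ', hCS⟩ := h₂ G r sch Δ hΔ hW hPVG hUU hSlab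
  -- landed compactness: a sub-scheme with convergent canonical curvature products
  obtain ⟨ψ, hψ, -, hconv⟩ :=
    exists_subseq_convProducts_of_uuvb r sch hUU Set.univ
      ((Filter.Eventually.of_forall fun k => Set.mem_univ k).frequently)
  -- transport every clause along `ψ`
  have hW2 : (subScheme sch ψ hψ).HasWeakCouplingLimit := hasWeakCouplingLimit_subScheme hW ψ hψ
  have hPVG2 : PolyVolumeGrowth (subScheme sch ψ hψ) := polyVolumeGrowth_subScheme sch ψ hψ hPVG
  have hUU2 : UUVB r (subScheme sch ψ hψ) := uuvb_subScheme r sch ψ hψ hUU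
  have hND2' : ND2 r (subScheme sch ψ hψ) := nd2_subScheme r sch ψ hψ hND2
  have hND3' : ND3 r (subScheme sch ψ hψ) := nd3_subScheme r sch ψ hψ hND3
  have hCS2 : SpeciesScheme.HasCSClustering r (canon r (subScheme sch ψ hψ)) Δ' :=
    hasCSClustering_canon_subScheme r sch ψ hψ hCS
  -- Stub 4: rotations; landed: translations, E0′, reflection positivity, approximate RP, uniform clustering
  have hRot : AsympRot r (subScheme sch ψ hψ) := h₄ G hG r _ hW2 hPVG2 hconv hUU2
  have hTr : AsympTransl r (subScheme sch ψ hψ) := stub_transl G r _ hPVG2 hUU2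
  have hE1 : AsympEuclid r (subScheme sch ψ hψ) := (asympEuclid_iff r _).2 ⟨hTr, hRot⟩
  have hUVB2 : UVB r (subScheme sch ψ hψ) := uvb_of_uuvb r _ hUU2
  have hRP2 : TorusSlabRP r (subScheme sch ψ hψ) := torusSlabRP_of_tendsto r _ hW2
  have hARP2 : ARP r (subScheme sch ψ hψ) := stub_arp G r _ hRP2 hUU2 hUVB2
  have hUCL2 : UCL r (subScheme sch ψ hψ) :=
    stub_uclOfCscl G r _ stub_asympCS stub_smallRotation stub_bddSlabDensity hW2 hUU2 hPVG2 hRot ⟨Δ', hΔ', hCS2⟩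
  -- landed one-field Osterwalder–Schrader packaging over ALL species
  obtain ⟨T, hYM, hNT, hNG⟩ := oneFieldOSLegs' G r _ hconv hUVB2 hE1 hARP2 hUCL2 hND2' hND3'
  -- the two gap clauses at the common rate `min Δ Δ'`
  have hMG : T.HasMassGap (min Δ Δ') :=
    hYM.hasMassGap_of_hasCSClustering (hasCSClustering_mono r _ (min_le_right Δ Δ') hCS2)
  have hLG : HasLatticeMassGap r (canon r (subScheme sch ψ hψ)) (min Δ Δ') :=
    hasLatticeMassGap_mono r _ (min_le_left Δ Δ') (hasLatticeMassGap_subScheme hGap ψ hψ)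
  exact ⟨canon r (subScheme sch ψ hψ), T, hW2, hYM, hNT, hNG, min Δ Δ', lt_min hΔ hΔ', hMG, hLG⟩

/-- **Composition**: the six stubs BY NAME, fed to `compose`, give the crux BY NAME (the kernel checks that every
registered stub signature instantiates the corresponding hypothesis of the glue). -/
theorem ContinuumFromMixing_of :
    Summit.QuantumFields.YangMills.Theses.ThermalRuler.ContinuumFromMixing :=
  compose stub_mixingTransfer stub_csClusteringTransfer stub_uniformUVBounds stub_rotationRestoration stub_scaleComparability stub_nonDegenerateCurvature

/-- Signature match, restated as an `example`. -/
example : Summit.QuantumFields.YangMills.Theses.ThermalRuler.ContinuumFromMixing := ContinuumFromMixing_of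

end Summit.QuantumFields.YangMills.Cruxes.ContinuumFromMixing.Birth

end
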